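import Summits.CriticalPhenomena.CardyFormulaZ2.Theorems.CardyBoundaryCoulombGasBoundaryDefectGaussianRStubRigidityOfLocalLawsPart7
import Summits.CriticalPhenomena.CardyFormulaZ2.Theorems.CardyBoundaryCoulombGasBoundaryDefectGaussianRStubReferenceLimitPart3

/-!
# Stub `stub_transportPaths` of line `rainbow-monomials-in-excursion-kernels` — Part 10:
# composing transport paths, and admissibility across a corner jump
# (crux `CardyBoundaryCoulombGas.BoundaryDefectGaussianR`, stmt-CriticalPhenomena-14132)

Two geometry-free tools for the route execution (T5) of TRANSPORT:

* `tp_path_refl`, `tp_path_slide`, `tp_path_jump`, `tp_path_trans` — the bookkeeping of the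
  conclusion `∃ T q σ, q 0 = P ∧ q T = Q ∧ #jumps ≤ N ∧ (∀ t ≤ T, Good (q t)) ∧
  (∀ t < T, Step (q t) (q (t+1)) (σ t))` of TRANSPORT, for ABSTRACT predicates `Good`, `Step`:
  trivial path, one slide (`σ = true`, no jump counted), one jump (`σ = false`), concatenation
  (times and jump counts add);
* `tp_admissible_jump` — admissibility of the rainbow datum survives moving ONE point (a source or
  the sink) to any vertex with exactly one outside neighbour whose exterior dart is linked to the
  old one by the boundary walk (`dsucc^[g]` forwards or backwards — the corner traversals of
  Part 9), provided the configuration stays injective and `ℓ∞`-separated by `≥ Σ legs`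
  (`s3_of_admissible`, `s3_cycle_orbit`, `s3_admissible_of_dist`).
All [folklore].
-/

noncomputable section

namespace Summit.CriticalPhenomena.CardyFormulaZ2.Cruxes.BoundaryDefectGaussianR.RainbowMonomialsInExcursionKernels

open Literature.Probability.LatticeModels Literature.Probability.LatticeModels.CollarLegModel

/-! ### Composing paths -/

section Paths

variable {α : Type*} (Good : α → Prop) (Step : α → α → Bool → Prop)

/-- The trivial path. [folklore] -/
theorem tp_path_refl {P : α} (hP : Good P) :
    ∃ (q : ℕ → α) (σ : ℕ → Bool), q 0 = P ∧ q 0 = P ∧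
      ((Finset.range 0).filter (fun t => σ t = false)).card ≤ 0 ∧
      (∀ t, t ≤ 0 → Good (q t)) ∧ (∀ t, t < 0 → Step (q t) (q (t + 1)) (σ t)) :=
  ⟨fun _ => P, fun _ => true, rfl, rfl, by simp, fun t ht => by rwa [Nat.le_zero.1 ht],
    fun t ht => absurd ht (Nat.not_lt_zero t)⟩

/-- A one-step path along a slide (`σ = true`; no jump counted). [folklore] -/
theorem tp_path_slide {P Q : α} (hP : Good P) (hQ : Good Q) (hs : Step P Q true) :
    ∃ (q : ℕ → α) (σ : ℕ → Bool), q 0 = P ∧ q 1 = Q ∧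
      ((Finset.range 1).filter (fun t => σ t = false)).card ≤ 0 ∧
      (∀ t, t ≤ 1 → Good (q t)) ∧ (∀ t, t < 1 → Step (q t) (q (t + 1)) (σ t)) := by
  refine ⟨fun t => if t = 0 then P else Q, fun _ => true, by simp, by simp, by simp, ?_, ?_⟩
  · intro t ht
    by_cases h : t = 0
    · simp [h, hP]
    · simp [h, hQ]
  · intro t ht
    have h0 : t = 0 := by omega
    subst h0
    simpa using hs

/-- A one-step path along a jump (`σ = false`; one jump counted). [folklore] -/
theorem tp_path_jump {P Q : α} (hP : Good P) (hQ : Good Q) (hs : Step P Q false) :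
    ∃ (q : ℕ → α) (σ : ℕ → Bool), q 0 = P ∧ q 1 = Q ∧
      ((Finset.range 1).filter (fun t => σ t = false)).card ≤ 1 ∧
      (∀ t, t ≤ 1 → Good (q t)) ∧ (∀ t, t < 1 → Step (q t) (q (t + 1)) (σ t)) := by
  refine ⟨fun t => if t = 0 then P else Q, fun _ => false, by simp, by simp, by simp, ?_, ?_⟩
  · intro t ht
    by_cases h : t = 0
    · simp [h, hP]
    · simp [h, hQ]
  · intro t ht
    have h0 : t = 0 := by omega
    subst h0
    simpa using hs

/-- **Concatenation of paths**: times and jump counts add. [folklore] -/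
theorem tp_path_trans {P Q R : α} {T₁ T₂ N₁ N₂ : ℕ}
    (h₁ : ∃ (q : ℕ → α) (σ : ℕ → Bool), q 0 = P ∧ q T₁ = Q ∧
      ((Finset.range T₁).filter (fun t => σ t = false)).card ≤ N₁ ∧
      (∀ t, t ≤ T₁ → Good (q t)) ∧ (∀ t, t < T₁ → Step (q t) (q (t + 1)) (σ t)))
    (h₂ : ∃ (q : ℕ → α) (σ : ℕ → Bool), q 0 = Q ∧ q T₂ = R ∧
      ((Finset.range T₂).filter (fun t => σ t = false)).card ≤ N₂ ∧
      (∀ t, t ≤ T₂ → Good (q t)) ∧ (∀ t, t < T₂ → Step (q t) (q (t + 1)) (σ t))) :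
    ∃ (q : ℕ → α) (σ : ℕ → Bool), q 0 = P ∧ q (T₁ + T₂) = R ∧
      ((Finset.range (T₁ + T₂)).filter (fun t => σ t = false)).card ≤ N₁ + N₂ ∧
      (∀ t, t ≤ T₁ + T₂ → Good (q t)) ∧ (∀ t, t < T₁ + T₂ → Step (q t) (q (t + 1)) (σ t)) := by
  obtain ⟨q₁, σ₁, h10, h1T, h1c, h1g, h1s⟩ := h₁
  obtain ⟨q₂, σ₂, h20, h2T, h2c, h2g, h2s⟩ := h₂
  set q : ℕ → α := fun t => if t ≤ T₁ then q₁ t else q₂ (t - T₁) with hq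
  set σ : ℕ → Bool := fun t => if t < T₁ then σ₁ t else σ₂ (t - T₁) with hσ
  have hqT₁ : ∀ t, T₁ ≤ t → q t = q₂ (t - T₁) := by
    intro t ht
    simp only [hq]
    by_cases h : t ≤ T₁
    · have : t = T₁ := le_antisymm h ht
      subst this
      simp [h1T, h20]
    · simp [h]
  refine ⟨q, σ, by simp [hq, h10], ?_, ?_, ?_, ?_⟩
  · rw [hqT₁ _ (Nat.le_add_right _ _), Nat.add_sub_cancel_left, h2T]
  · -- jump counts add
    rw [Finset.card_filter, Finset.sum_range_add]
    rw [Finset.card_filter] at h1c h2c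
    have e1 : ∑ t ∈ Finset.range T₁, (if σ t = false then 1 else 0) =
        ∑ t ∈ Finset.range T₁, (if σ₁ t = false then 1 else 0) := by
      refine Finset.sum_congr rfl fun t ht => ?_
      have ht' : t < T₁ := Finset.mem_range.1 ht
      simp [hσ, ht']
    have e2 : ∑ t ∈ Finset.range T₂, (if σ (T₁ + t) = false then 1 else 0) =
        ∑ t ∈ Finset.range T₂, (if σ₂ t = false then 1 else 0) := by
      refine Finset.sum_congr rfl fun t _ => ?_
      simp [hσ]
    rw [e1, e2]
    exact Nat.add_le_add h1c h2c
  · intro t ht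
    by_cases h : t ≤ T₁
    · simp only [hq, h, if_true]; exact h1g t h
    · rw [hqT₁ t (by omega)]; exact h2g _ (by omega)
  · intro t ht
    by_cases h : t < T₁
    · have e1 : q t = q₁ t := by simp [hq, h.le]
      have e2 : q (t + 1) = q₁ (t + 1) := by simp [hq, Nat.succ_le_of_lt h]
      have e3 : σ t = σ₁ t := by simp [hσ, h]
      rw [e1, e2, e3]
      exact h1s t h
    · push Not at h
      have e3 : σ t = σ₂ (t - T₁) := by simp [hσ, Nat.not_lt.2 h]
      rw [hqT₁ t h, hqT₁ (t + 1) (by omega), e3, show t + 1 - T₁ = t - T₁ + 1 by omega]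
      exact h2s _ (by omega)

end Paths

/-! ### Admissibility across a corner jump -/

/-- Predecessor closure of a boundary cycle, iterated: if `e` is an exterior dart and
`dsucc^[g] e` lies on the cycle through the exterior dart `d`, then so does `e`. [folklore] -/
theorem tp_cycle_of_iterate (V : Finset (ℤ × ℤ)) (d : Dart) (hd : d.1 ∈ V) (hdt : dartTip d ∉ V) :
    ∀ (g : ℕ) (e : Dart), e.1 ∈ V → dartTip e ∉ V →
      (dsucc V)^[g] e ∈ cycle V d → e ∈ cycle V d := by
  intro g
  induction g with
  | zero => intro e _ _ h; simpa using h
  | succ g ih =>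
    intro e he het h
    rw [Function.iterate_succ_apply] at h
    obtain ⟨he', het'⟩ := s3_dsucc_exterior V e he het
    exact (s3_cycle_orbit V d hd hdt).2.2.2.2.1 e he het (ih _ he' het' h)

/-- **Admissibility across a jump.** For an injective configuration `p : Fin k → ℤ²` with
admissible rainbow datum on `V`, replace `p i` (a source OR the sink) by a vertex `y ∈ V` with
exactly one outside neighbour, whose exterior dart `dy` is linked to the exterior dart `dx` of
`p i` by the boundary walk (`dsucc^[g] dx = dy` or `dsucc^[g] dy = dx`); if the new configuration
is injective and `ℓ∞`-separated by `G ≥ Σ_{b ≠ j} L b`, its rainbow datum is admissible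
(every point's dart lies on the boundary cycle of the new sink dart: `s3_of_admissible`,
`s3_cycle_orbit`, `s3_admissible_of_dist`). [folklore] -/
theorem tp_admissible_jump (k : ℕ) (L : Fin k → ℕ) (j : Fin k) (V : Finset (ℤ × ℤ))
    (p : Fin k → ℤ × ℤ) (i : Fin k) (y : ℤ × ℤ) (G : ℕ) (hp : Function.Injective p)
    (hp' : Function.Injective (Function.update p i y))
    (hadm : LegInsertionData.IsAdmissible
      (⟨(Finset.univ.erase j).image p, fun v ↦ ∑ b ∈ (Finset.univ.erase j).filter (fun b ↦ p b = v),
        L b, p j⟩ : LegInsertionData) V)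
    (hyV : y ∈ V) (hyc : ((neighbours y).filter (fun z ↦ z ∉ V)).card = 1)
    (hlink : ∃ (dx dy : Dart) (g : ℕ), outDart V (p i) = some dx ∧ outDart V y = some dy ∧
      ((dsucc V)^[g] dx = dy ∨ (dsucc V)^[g] dy = dx))
    (hG : ∑ b ∈ Finset.univ.erase j, L b ≤ G)
    (hsep : ∀ a b : Fin k, a ≠ b → (G : ℤ) ≤
      max |(Function.update p i y a).1 - (Function.update p i y b).1|
        |(Function.update p i y a).2 - (Function.update p i y b).2|) :
    LegInsertionData.IsAdmissible
      (⟨(Finset.univ.erase j).image (Function.update p i y),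
        fun v ↦ ∑ b ∈ (Finset.univ.erase j).filter (fun b ↦ Function.update p i y b = v), L b,
        Function.update p i y j⟩ : LegInsertionData) V := by
  set p' := Function.update p i y with hp'def
  have hk : ∃ b, b ≠ j := by
    obtain ⟨⟨x, hx⟩, -⟩ := hadm
    obtain ⟨b, hb, -⟩ := Finset.mem_image.1 hx
    exact ⟨b, (Finset.mem_erase.1 hb).1⟩
  have hLpos : ∀ b, b ≠ j → 1 ≤ L b := by
    intro b hb
    obtain ⟨-, hlegs, -⟩ := hadm
    have hm : b ∈ Finset.univ.erase j := Finset.mem_erase.2 ⟨hb, Finset.mem_univ _⟩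
    have hsum : ∑ b' ∈ (Finset.univ.erase j).filter (fun b' ↦ p b' = p b), L b' = L b :=
      Finset.sum_eq_single_of_mem b (Finset.mem_filter.2 ⟨hm, rfl⟩)
        (fun b' hb' hne ↦ absurd (hp (Finset.mem_filter.1 hb').2) hne)
    have := hlegs (p b) (Finset.mem_image_of_mem p hm)
    simp only at this
    rwa [hsum] at this
  -- the old sink dart and the old points' darts
  obtain ⟨d₀, hd₀, -, hd₀V, hd₀t, hpts⟩ := s3_of_admissible _ V hadm
  have horb := s3_cycle_orbit V d₀ hd₀V hd₀t
  have hold : ∀ c : Fin k, p c ∈ insert (p j) ((Finset.univ.erase j).image p) := by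
    intro c
    by_cases hc : c = j
    · subst hc; exact Finset.mem_insert_self _ _
    · exact Finset.mem_insert_of_mem
        (Finset.mem_image_of_mem p (Finset.mem_erase.2 ⟨hc, Finset.mem_univ c⟩))
  have holdpt : ∀ c : Fin k, p c ∈ V ∧ ((neighbours (p c)).filter (fun z ↦ z ∉ V)).card = 1 ∧
      ∃ e ∈ cycle V d₀, outDart V (p c) = some e := by
    intro c
    obtain ⟨hV, hc1, m, -, hm⟩ := hpts (p c) (hold c)
    exact ⟨hV, hc1, _, horb.2.2.1 m, hm⟩
  -- the new point's dart lies on the old cycle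
  obtain ⟨dx, dy, g, hdx, hdy, hlink⟩ := hlink
  have hdyx : dy.1 = y ∧ y + dir dy.2 ∉ V := s3_outDart_some V y dy hdy
  have hdycyc : dy ∈ cycle V d₀ := by
    obtain ⟨-, -, e, he, hex⟩ := holdpt i
    rw [hdx] at hex
    have hed : dx = e := Option.some.inj hex
    subst hed
    obtain ⟨m, -, rfl⟩ := (horb.1 dx).1 he
    rcases hlink with h | h
    · rw [← h, ← Function.iterate_add_apply]
      exact horb.2.2.1 _
    · refine tp_cycle_of_iterate V d₀ hd₀V hd₀t g dy (hdyx.1.symm ▸ hyV) ?_ ?_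
      · simp only [dartTip]; rw [hdyx.1]; exact hdyx.2
      · rw [h]; exact horb.2.2.1 m
  -- the new sink dart
  obtain ⟨d₀', hd₀', hd₀'cyc⟩ : ∃ d₀' : Dart, outDart V (p' j) = some d₀' ∧ d₀' ∈ cycle V d₀ := by
    by_cases hji : j = i
    · refine ⟨dy, ?_, hdycyc⟩
      have : p' j = y := by simp [hp'def, hji]
      rw [this]; exact hdy
    · refine ⟨d₀, ?_, by simpa using horb.2.2.1 0⟩
      have : p' j = p j := by simp [hp'def, hji]
      rw [this]; exact hd₀
  have hsame : ∀ x, x ∈ cycle V d₀' ↔ x ∈ cycle V d₀ := (horb.2.2.2.2.2 d₀' hd₀'cyc).2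
  -- conclude by the index-free criterion
  refine s3_admissible_of_dist _ V d₀' G (rainbow_source_nonempty j p' hk)
    (rainbow_legs_pos L j p' hLpos) (rainbow_sink_not_mem j p' hp') hd₀' ?_ ?_ ?_
  · intro x hx
    obtain ⟨c, rfl⟩ := rainbow_mem_insert j p' hx
    by_cases hci : c = i
    · subst hci
      have hpc : p' c = y := by simp [hp'def]
      rw [hpc]
      exact ⟨hyV, hyc, dy, (hsame dy).2 hdycyc, hdyx.1⟩
    · have hpc : p' c = p c := by simp [hp'def, hci]
      rw [hpc]
      obtain ⟨hV, hc1, e, he, hex⟩ := holdpt c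
      exact ⟨hV, hc1, e, (hsame e).2 he, (s3_outDart_some V (p c) e hex).1⟩
  · -- `sinkLegs' = Σ_{b ≠ j} L b ≤ G`
    unfold LegInsertionData.sinkLegs
    simp only
    rw [Finset.sum_fiberwise_of_maps_to (fun b hb ↦ Finset.mem_image_of_mem p' hb)]
    exact hG
  · intro x hx x' hx' hne
    obtain ⟨a, rfl⟩ := rainbow_mem_insert j p' hx
    obtain ⟨b, rfl⟩ := rainbow_mem_insert j p' hx'
    exact hsep a b (fun h ↦ hne (h ▸ rfl))

/-- **Registered sub-goal `s7_admissibleJump` of stub `stub_transportPaths`** (admissibility across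
a corner jump, one-line form of `tp_admissible_jump`). [folklore] -/
theorem s7_admissibleJump : ∀ (k : ℕ) (L : Fin k → ℕ) (j : Fin k) (V : Finset (ℤ × ℤ)) (p : Fin k → ℤ × ℤ) (i : Fin k) (y : ℤ × ℤ) (G : ℕ), Function.Injective p → Function.Injective (Function.update p i y) → Literature.Probability.LatticeModels.CollarLegModel.LegInsertionData.IsAdmissible (⟨(Finset.univ.erase j).image p, fun v ↦ ∑ b ∈ (Finset.univ.erase j).filter (fun b ↦ p b = v), L b, p j⟩ : Literature.Probability.LatticeModels.CollarLegModel.LegInsertionData) V → y ∈ V → ((Literature.Probability.LatticeModels.CollarLegModel.neighbours y).filter (fun z ↦ z ∉ V)).card = 1 → (∃ (dx dy : Literature.Probability.LatticeModels.CollarLegModel.Dart) (g : ℕ), Literature.Probability.LatticeModels.CollarLegModel.outDart V (p i) = some dx ∧ Literature.Probability.LatticeModels.CollarLegModel.outDart V y = some dy ∧ ((Literature.Probability.LatticeModels.CollarLegModel.dsucc V)^[g] dx = dy ∨ (Literature.Probability.LatticeModels.CollarLegModel.dsucc V)^[g] dy = dx)) → ∑ b ∈ Finset.univ.erase j, L b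 ≤ G → (∀ a b : Fin k, a ≠ b → (G : ℤ) ≤ max |(Function.update p i y a).1 - (Function.update p i y b).1| |(Function.update p i y a).2 - (Function.update p i y b).2|) → Literature.Probability.LatticeModels.CollarLegModel.LegInsertionData.IsAdmissible (⟨(Finset.univ.erase j).image (Function.update p i y), fun v ↦ ∑ b ∈ (Finset.univ.erase j).filter (fun b ↦ Function.update p i y b = v), L b, Function.update p i y j⟩ : Literature.Probability.LatticeModels.CollarLegModel.LegInsertionData) V :=
  fun k L j V p i y G hp hp' hadm hyV hyc hlink hG hsep =>
    tp_admissible_jump k L j V p i y G hp hp' hadm hyV hyc hlink hG hsep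

end Summit.CriticalPhenomena.CardyFormulaZ2.Cruxes.BoundaryDefectGaussianR.RainbowMonomialsInExcursionKernels

end
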